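import Summits.Ventures.PercRepro.SixFourResidueGeneric

/-!
# PercRepro — C-025 at `(6,4)`: Theorem G for EVERY `g`, part A — the uncapped prices, the per-pair inequality at
`t = 4`, and the partner bound without the cap (p3, gen 11 — §21.13.1–§21.13.3)

The `t = 4` twin of p2's `SixFourResidueThreeGenericAll.lean`, first half.  The prices as functions of `g`:
`y_P(g) = F(g)/C(g,2)`, `y_m(g) = [y_P·C(m,2) + bonus(m) + (2/3)·ε(m)·C(g − m, 2)]/(g − m)` (`yP4`, `yPrice4`,
`price_identity4`, `Fg_eq_yP4`); the crude partner charge `Ξ_g(p − 1) = 2^{1 + min(2p − g, p − 1)}` of a plane with `p`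
points (`xiCrude`; §21.13.3 bounds the partner term of §21.13.2 by the longest possible line `p − 1`); the additive
line terms `L(g,p,m) = y_m(p − m) + (g − p − 2/5)·δ(m) − (8/5)·C(m,4) − (2/3)·ε(m)·C(p − m, 2)` and
`base(g,p) = (g − p − 2/5)·δ(p) − (8/5)·C(p,4)` (`Lterm4`, `base4`); **the per-pair inequality**
`PerPair4 g p m : C(m,2)·[base(g,p) + (6/5)·Ξ_g(p − 1)] ≤ C(p,2)·L(g,p,m)` (mine-2's `T(g,p) ≥ 0` in per-pair form);
the line-sum form of `r₃(ρ,4)` (`r34_add_sum_choose_four_lines`); and **the partner bound without the cap**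
(§21.13.2, `Xcnt_le_sum_xiCrude`): for a generic `G`, `X ≤ Σ_{P : r(P ∩ G) = 3} Ξ_g(|P ∩ G| − 1)` — the larger plane
`ψ` of each partner pair pays `2·#fiber ψ ≤ 2^{|λ_ψ| + 1}` with `|λ_ψ| = p + p′ − g ≤ 2p − g` and `λ_ψ ⊊ ψ ∩ G` (the
fibre / partner / `λ` machinery of `SixFourT4XA.lean`, now with no numeric cap).  The certificate and the sum over
the planes are in `SixFourResidueFourGenericAll.lean`.
-/

namespace PercRepro.SixFour

/-! ## The prices as functions of `g` -/

/-- `y_P(g) = F(g)/C(g,2)`. -/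
noncomputable def yP4 (g : ℕ) : ℚ := Fg g / (g.choose 2 : ℚ)

/-- `y_m(g) = [y_P(g)·C(m,2) + bonus(m) + (2/3)·ε(m)·C(g − m, 2)]/(g − m)`. -/
noncomputable def yPrice4 (g m : ℕ) : ℚ :=
  (yP4 g * (m.choose 2 : ℚ) + bonus m + 2 / 3 * ((eps m : ℚ) * ((g - m).choose 2 : ℚ))) / ((g - m : ℕ) : ℚ)

/-- The price identity, for `m < g`. -/
theorem price_identity4 {g m : ℕ} (hm : m < g) :
    yPrice4 g m * ((g - m : ℕ) : ℚ) =
      yP4 g * (m.choose 2 : ℚ) + bonus m + 2 / 3 * ((eps m : ℚ) * ((g - m).choose 2 : ℚ)) := by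
  unfold yPrice4
  have h : ((g - m : ℕ) : ℚ) ≠ 0 := by
    have : 0 < g - m := by omega
    positivity
  field_simp

/-- `F(g) = y_P(g)·C(g,2)` for `g ≥ 2`. -/
theorem Fg_eq_yP4 {g : ℕ} (hg : 2 ≤ g) : Fg g = yP4 g * (g.choose 2 : ℚ) := by
  unfold yP4
  have h : (g.choose 2 : ℚ) ≠ 0 := by
    have : 0 < g.choose 2 := Nat.choose_pos hg
    positivity
  field_simp

/-- `y_0 = 0`. -/
theorem yPrice4_zero (g : ℕ) : yPrice4 g 0 = 0 := by
  simp [yPrice4, bonus, eps, delta, S3]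

/-- `y_1 = 0`. -/
theorem yPrice4_one (g : ℕ) : yPrice4 g 1 = 0 := by
  simp [yPrice4, bonus, eps, delta, S3]

/-! ## The crude partner bound `Ξ_g(p − 1)` -/

/-- `Ξ_g(p − 1) = 2^{1 + min(2p − g, p − 1)}` if `2p ≥ g`, else `0`: the partner charge of a plane with `p` points,
bounded without reference to its line profile (§21.13.2 / §21.13.3). -/
def xiCrude (g p : ℕ) : ℕ := if 2 * p < g then 0 else 2 ^ (1 + min (2 * p - g) (p - 1))

/-! ## The additive certificate -/

/-- `L(g,p,m) = y_m(p − m) + (g − p − 2/5)·δ(m) − (8/5)·C(m,4) − (2/3)·ε(m)·C(p − m, 2)`. -/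
noncomputable def Lterm4 (g p m : ℕ) : ℚ :=
  yPrice4 g m * ((p - m : ℕ) : ℚ) + ((g : ℚ) - p - 2 / 5) * (delta m : ℚ) - 8 / 5 * (m.choose 4 : ℚ) -
    2 / 3 * ((eps m : ℚ) * ((p - m).choose 2 : ℚ))

/-- `base(g,p) = (g − p − 2/5)·δ(p) − (8/5)·C(p,4)`. -/
noncomputable def base4 (g p : ℕ) : ℚ :=
  ((g : ℚ) - p - 2 / 5) * (delta p : ℚ) - 8 / 5 * (p.choose 4 : ℚ)

/-- **The per-pair inequality at `t = 4`** (§21.13.3): `C(m,2)·[base(g,p) + (6/5)·Ξ_g(p − 1)] ≤ C(p,2)·L(g,p,m)`. -/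
def PerPair4 (g p m : ℕ) : Prop :=
  (m.choose 2 : ℚ) * (base4 g p + 6 / 5 * (xiCrude g p : ℚ)) ≤ (p.choose 2 : ℚ) * Lterm4 g p m

/-- `L(g,p,m) = 0` for `m ≤ 1`. -/
theorem Lterm4_eq_zero_of_le_one (g p : ℕ) {m : ℕ} (hm : m ≤ 1) : Lterm4 g p m = 0 := by
  interval_cases m
  · simp [Lterm4, yPrice4_zero, delta, eps, S3]
  · simp [Lterm4, yPrice4_one, delta, eps, S3]

/-- `PerPair4` holds trivially for `m ≤ 1`. -/
theorem perPair4_of_le_one (g p : ℕ) {m : ℕ} (hm : m ≤ 1) : PerPair4 g p m := by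
  unfold PerPair4
  rw [Lterm4_eq_zero_of_le_one g p hm]
  interval_cases m <;> simp

open Finset ThmH

variable {α : Type*} [DecidableEq α] {M : Matroid α} [M.Finite] {G : Finset α}

/-- `r₃(ρ,4) + Σ_λ C(m_λ, 4) = C(p, 4)` for every rank-`3` trace (the `4`-subsets have rank `3` or `2`). -/
theorem r34_add_sum_choose_four_lines (hs : Simple M) (hG : G ⊆ gr M) {P : Finset α}
    (hr : M.eRk ((P ∩ G : Finset α) : Set α) = 3) :
    r34 M G P + ∑ L ∈ lines M, (L ∩ (P ∩ G)).card.choose 4 = (P ∩ G).card.choose 4 := by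
  set ρ := P ∩ G with hρdef
  have hρ : ρ ⊆ gr M := Finset.inter_subset_right.trans hG
  have hsplit := Finset.card_filter_add_card_filter_not (s := ρ.powersetCard 4)
    (fun Z : Finset α => M.eRk (Z : Set α) = 3)
  have hcongr : (ρ.powersetCard 4).filter (fun Z : Finset α => ¬ M.eRk (Z : Set α) = 3) =
      (ρ.powersetCard 4).filter (fun Z : Finset α => M.eRk (Z : Set α) = 2) := by
    refine Finset.filter_congr (fun Z hZ => ?_)
    obtain ⟨hZρ, hc⟩ := Finset.mem_powersetCard.1 hZ
    have hle : M.eRk (Z : Set α) ≤ 3 := by rw [← hr]; exact M.eRk_mono (Finset.coe_subset.2 hZρ)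
    constructor
    · intro hne
      refine le_antisymm ?_ (two_le_eRk_of_two_le_card hs hρ hZρ (by omega))
      by_contra h
      exact hne (eRk_eq_of_le_of_not_le (n := 2) hle h)
    · intro h2; rw [h2]; decide
  rw [hcongr, card_rank_two_subsets hs hρ (by norm_num : 2 ≤ 4), Finset.card_powersetCard] at hsplit
  exact hsplit

/-- No line meets a finset `ρ` in more than `|ρ|` points. -/
theorem inc_eq_zero_of_lt_card (ρ : Finset α) {n : ℕ} (hn : ρ.card < n) : inc M ρ n = 0 := by
  unfold inc
  rw [Finset.card_eq_zero, Finset.filter_eq_empty_iff]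
  intro L _ hL
  have := Finset.card_le_card (Finset.inter_subset_right (s₁ := L) (s₂ := ρ))
  omega

/-- The right side of the additive certificate for the plane `P`: `Σ_λ y_{m_λ}·(p − m_λ)`. -/
noncomputable def certRHS4 (M : Matroid α) [M.Finite] (G P : Finset α) (g : ℕ) : ℚ :=
  ∑ L ∈ lines M, yPrice4 g (L ∩ (P ∩ G)).card * (((P ∩ G).card - (L ∩ (P ∩ G)).card : ℕ) : ℚ)

/-! ## The partner bound without the cap (§21.13.2) -/

/-- For a plane `ψ` at least as large as its partner: `2·#fiber ψ ≤ Ξ_g(p − 1)` (`|λ_ψ| ≤ 2p − g` and `λ_ψ ⊊ ψ ∩ G`). -/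
theorem two_mul_card_fiber_le_xiCrude (hG : G ⊆ gr M) (hr : M.eRk (G : Set α) = 4) (hgen : Generic M G)
    {P : Finset α} (hP : P ∈ planes M) (hlarge : (partner M G P ∩ G).card ≤ (P ∩ G).card) :
    2 * (fiber M G P).card ≤ xiCrude G.card (P ∩ G).card := by
  by_cases hne : (fiber M G P).Nonempty
  · have hfl := card_fiber_le hG hr hgen hP
    have hlam := card_lambda hG hr hgen hP hne
    have hlt : (lambda M G P).card < (P ∩ G).card := by
      have hsub : lambda M G P ⊆ P ∩ G := by
        intro x hx
        unfold lambda at hx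
        rw [Finset.mem_inter, Finset.mem_inter] at hx
        exact Finset.mem_inter.2 ⟨hx.1.1, hx.2⟩
      have hr3 := eRk_trace_eq_three_of_fiber_nonempty hG hr hgen hP hne
      have hl2 := eRk_lambda_le_two hG hr hgen hP hne
      apply Finset.card_lt_card
      refine ⟨hsub, fun h => ?_⟩
      have := M.eRk_mono (Finset.coe_subset.2 h)
      rw [hr3] at this
      exact absurd (this.trans hl2) (by decide)
    unfold xiCrude
    rw [if_neg (by omega)]
    calc 2 * (fiber M G P).card ≤ 2 * 2 ^ (lambda M G P).card := by omega
      _ = 2 ^ ((lambda M G P).card + 1) := by ring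
      _ ≤ 2 ^ (1 + min (2 * (P ∩ G).card - G.card) ((P ∩ G).card - 1)) :=
          Nat.pow_le_pow_right (by norm_num) (by omega)
  · rw [Finset.not_nonempty_iff_eq_empty] at hne
    rw [hne, Finset.card_empty, mul_zero]
    exact Nat.zero_le _

/-- **§21.13.2**: for a generic `G`, `X ≤ Σ_{P ∈ planes M, r(P ∩ G) = 3} Ξ_g(|P ∩ G| − 1)`. -/
theorem Xcnt_le_sum_xiCrude (hG : G ⊆ gr M) (hr : M.eRk (G : Set α) = 4) (hgen : Generic M G) :
    Xcnt M G ≤ ∑ P ∈ (planes M).filter (fun P : Finset α => M.eRk ((P ∩ G : Finset α) : Set α) = 3),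
      xiCrude G.card (P ∩ G).card := by
  rw [Xcnt_eq_card_Xset, card_Xset_eq_sum_fiber hG hr hgen]
  rw [← Finset.sum_filter_add_sum_filter_not (planes M)
    (fun P : Finset α => (partner M G P ∩ G).card ≤ (P ∩ G).card) (fun P => (fiber M G P).card)]
  have hsmall := sum_fiber_small_le hG hr hgen
  set A := (planes M).filter (fun P : Finset α => (partner M G P ∩ G).card ≤ (P ∩ G).card) with hA
  set A' := A.filter (fun P : Finset α => (fiber M G P).Nonempty) with hA'
  have h1 : ∑ P ∈ A, (fiber M G P).card = ∑ P ∈ A', (fiber M G P).card :=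
    (Finset.sum_filter_of_ne (fun P _ hne => Finset.card_pos.1 (Nat.pos_of_ne_zero hne))).symm
  have hlarge : ∑ P ∈ A', 2 * (fiber M G P).card ≤ ∑ P ∈ A', xiCrude G.card (P ∩ G).card :=
    Finset.sum_le_sum (fun P hP => by
      rw [hA', Finset.mem_filter, hA, Finset.mem_filter] at hP
      exact two_mul_card_fiber_le_xiCrude hG hr hgen hP.1.1 hP.1.2)
  rw [← Finset.mul_sum] at hlarge
  have hsub : A' ⊆ (planes M).filter (fun P : Finset α => M.eRk ((P ∩ G : Finset α) : Set α) = 3) := by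
    intro P hP
    rw [hA', Finset.mem_filter, hA, Finset.mem_filter] at hP
    rw [Finset.mem_filter]
    exact ⟨hP.1.1, eRk_trace_eq_three_of_fiber_nonempty hG hr hgen hP.1.1 hP.2⟩
  have hsub' := Finset.sum_le_sum_of_subset_of_nonneg hsub
    (f := fun P => xiCrude G.card (P ∩ G).card) (fun _ _ _ => Nat.zero_le _)
  omega


end PercRepro.SixFour
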